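import Summits.CriticalPhenomena.PercolationContinuityZ3.Theorems.PercNearOneGluingNoHeavyLowerTailQuantitativeBHKAttachment
import Summits.CriticalPhenomena.PercolationContinuityZ3.Theorems.PercNearOneGluingNoHeavyLowerTailQuantitativeBHKRepulsionGlauber
import Literature.Probability.Percolation.KozmaNitzanPreFKG
import HarnessLib

/-!
# Level-0 CSH margin: the exact identity `margin = Harris term + repulsion slack`, and the slack floored by the attachment / Glauber members

Support file (`--supports stmt-CriticalPhenomena-4575`), prover seat `prim-rate-mine-2` (lane prim-rate, constants-miner (c), BENCH row
M2-R12; `run/shared/lean/prim/prim-rate/prim-rate-mine-2/CANDIDATES.md` §gen-2/§gen-3).  No definitions, no named facts, no sorries; standard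
axioms.  `x, b, o, v` vertices, `x ≠ v`; `D = {x ↮ v}`, `B = {x ↔ b}`, `Q = {v ↔ x}`, `O_x = {o ↔ x}`, `O_v = {o ↔ v}`, `U = O_x ∪ O_v`,
`m = μ(B)`.  The (K6) transfer behind paper Lemma 3.8 for the single relay `x` and the connection functional `1_B` is the EXACT identity

  `μ(D∩O_v)(μ(Q∩B) − μ(Q)m) + μ(D)(μ(U∩B) − μ(U)m) + R = μ(D)(μ(O_x∩B) − μ(O_x)m)`,  `R = μ(D∩O_v)μ(D∩B) − μ(D)μ(D∩O_v∩B)`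

(`QuantBHK.level0Margin_eq_harris_add_repulsion`; `R ≥ 0` is van den Berg–Häggström–Kahn's repulsion, BHK eq. (2)) — the row's first claim
«margin = H + R exactly», so that EVERY kernel floor of the two-cluster repulsion plugs in: the attachment member AS TYPED
(`level0Margin_ge_harris_add_attachment`, dominator form, weights supported on `E`; kernel `twoCluster_repulsion_openConn_ge_attachment`) and
the Glauber member (`level0Margin_ge_harris_add_glauber`, every pair `e`, all weights; kernel `twoCluster_repulsion_ge_glauberTerm`).  The
deletion member is `QuantBHK.level0Margin_ge_harris_add_deletion` (p316673); the blocking member follows the same way from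
`twoCluster_repulsion_openConn_ge_blocking`.
[cite: VandenbergHaggstromKahn2005, Thm. 1.4 and eq. (2) (pp. 2, 7)] [cite: Harris1960, Lemma 4.1 (p. 16)]
-/

noncomputable section

namespace Summit.CriticalPhenomena.PercolationContinuityZ3.Theorems

open MeasureTheory Set Literature.Probability.LatticeModels Literature.Probability.Percolation
open scoped Classical

namespace QuantBHK

universe v

variable {V : Type v} [Fintype V]

/-- **Level-0 CSH margin = Harris term + repulsion slack, exactly.**  With `D = {x ↮ v}`, `B = {x↔b}`, `Q = {v↔x}`, `O_x = {o↔x}`,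
`O_v = {o↔v}`, `U = O_x ∪ O_v`, `m = μ(B)`:
  `μ(D∩O_v)(μ(Q∩B) − μ(Q)m) + μ(D)(μ(U∩B) − μ(U)m) + (μ(D∩O_v)μ(D∩B) − μ(D)μ(D∩O_v∩B)) = μ(D)(μ(O_x∩B) − μ(O_x)m)`.
Pure bookkeeping (`U = O_x ⊔ (D ∩ O_v)`, `D = Qᶜ`); the bracket is BHK's two-cluster repulsion slack `R = μ(D)²·(−Cov(1_B, 1_{O_v} | D)) ≥ 0`.
This is the identity `M0 = H + R` of BENCH row M2-R12 (prim-rate lane). [cite: VandenbergHaggstromKahn2005, eq. (2) (p. 2)] -/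
theorem level0Margin_eq_harris_add_repulsion (w : Sym2 V → unitInterval) (x b o v : V) :
    (prodBernoulli w).real ({ω : BondConfig V | ¬ (openGraph ω).Reachable x v} ∩ openConn o v) *
          ((prodBernoulli w).real (openConn v x ∩ openConn x b) -
            (prodBernoulli w).real (openConn v x) * (prodBernoulli w).real (openConn x b)) +
        (prodBernoulli w).real {ω : BondConfig V | ¬ (openGraph ω).Reachable x v} *
          ((prodBernoulli w).real ((openConn o x ∪ openConn o v) ∩ openConn x b) -
            (prodBernoulli w).real (openConn o x ∪ openConn o v) * (prodBernoulli w).real (openConn x b)) +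
        ((prodBernoulli w).real ({ω : BondConfig V | ¬ (openGraph ω).Reachable x v} ∩ openConn o v) *
            (prodBernoulli w).real ({ω : BondConfig V | ¬ (openGraph ω).Reachable x v} ∩ openConn x b) -
          (prodBernoulli w).real {ω : BondConfig V | ¬ (openGraph ω).Reachable x v} *
            (prodBernoulli w).real ({ω : BondConfig V | ¬ (openGraph ω).Reachable x v} ∩ openConn o v ∩ openConn x b)) =
      (prodBernoulli w).real {ω : BondConfig V | ¬ (openGraph ω).Reachable x v} *
        ((prodBernoulli w).real (openConn o x ∩ openConn x b) -
          (prodBernoulli w).real (openConn o x) * (prodBernoulli w).real (openConn x b)) := by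
  set μ := prodBernoulli w with hμ
  have hmeas : ∀ T : Set (BondConfig V), MeasurableSet T := fun _ => MeasurableSet.of_discrete
  set D : Set (BondConfig V) := {ω : BondConfig V | ¬ (openGraph ω).Reachable x v} with hD
  set B : Set (BondConfig V) := openConn x b with hB
  set Q : Set (BondConfig V) := openConn v x with hQ
  set Ox : Set (BondConfig V) := openConn o x with hOx
  set Ov : Set (BondConfig V) := openConn o v with hOv
  -- `U = O_x ⊔ (D ∩ O_v)` and `D = Qᶜ`
  have hUdiff : (Ox ∪ Ov) \ Ox = D ∩ Ov := by
    ext ω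
    simp only [hOx, hOv, hD, mem_sdiff, mem_union, mem_inter_iff, openConn, mem_setOf_eq]
    constructor
    · rintro ⟨h | h, hno⟩
      · exact absurd h hno
      · exact ⟨fun hxv' => hno (h.trans hxv'.symm), h⟩
    · rintro ⟨hd, hov⟩
      exact ⟨Or.inr hov, fun hox => hd (hox.symm.trans hov)⟩
  have hUμ : μ.real (Ox ∪ Ov) = μ.real Ox + μ.real (D ∩ Ov) := by
    rw [← measureReal_inter_add_sdiff (s := Ox ∪ Ov) (h := measure_ne_top _ _) (hmeas Ox), inter_eq_right.2 subset_union_left, hUdiff]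
  have hUBμ : μ.real ((Ox ∪ Ov) ∩ B) = μ.real (Ox ∩ B) + μ.real (D ∩ Ov ∩ B) := by
    have h1 : ((Ox ∪ Ov) ∩ B) ∩ Ox = Ox ∩ B := by
      ext ω; simp only [mem_inter_iff, mem_union]; tauto
    have h2 : ((Ox ∪ Ov) ∩ B) \ Ox = D ∩ Ov ∩ B := by
      rw [← hUdiff]; ext ω; simp only [mem_inter_iff, mem_sdiff, mem_union]; tauto
    rw [← measureReal_inter_add_sdiff (s := (Ox ∪ Ov) ∩ B) (h := measure_ne_top _ _) (hmeas Ox), h1, h2]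
  have hDQ : D = Qᶜ := by
    ext ω
    simp only [hD, hQ, openConn, mem_compl_iff, mem_setOf_eq]
    exact ⟨fun h h' => h h'.symm, fun h h' => h h'.symm⟩
  have hDμ : μ.real D = 1 - μ.real Q := by
    have h1 : μ.real (univ : Set (BondConfig V)) = μ.real (univ ∩ Q) + μ.real (univ \ Q) :=
      (measureReal_inter_add_sdiff (s := univ) (h := measure_ne_top _ _) (hmeas Q)).symm
    rw [probReal_univ, univ_inter, ← compl_eq_univ_sdiff, ← hDQ] at h1
    linarith
  have hDBμ : μ.real (D ∩ B) = μ.real B - μ.real (Q ∩ B) := by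
    have h1 : μ.real B = μ.real (B ∩ Q) + μ.real (B \ Q) :=
      (measureReal_inter_add_sdiff (s := B) (h := measure_ne_top _ _) (hmeas Q)).symm
    have h2 : B \ Q = D ∩ B := by
      rw [hDQ]; ext ω; simp only [mem_sdiff, mem_inter_iff, mem_compl_iff]; tauto
    rw [Set.inter_comm B Q, h2] at h1
    linarith
  rw [hUμ, hUBμ, hDBμ, hDμ]
  ring

/-- **Level-0 CSH margin with the Harris term and the repulsion slack floored by the ATTACHMENT member AS TYPED** (weights supported on a pair
set `E`; notation of `level0Margin_eq_harris_add_repulsion`; `P_W(v↔o)` the residual connection probability off the pairs meeting `W`;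
`M : BondConfig V → ℝ` any function dominating every attachment value `P_{C_x ∪ U}(v↔o)`, `U` a vertex set through which `b` is joined to `x`
by pairs of `E` with endpoints in `C_x ∪ U` — e.g. the maximum over attachment sets, the (att) floor of BENCH row M2-R11):
  `μ(D∩O_v)(μ(Q∩B) − μ(Q)m) + μ(D)(μ(U∩B) − μ(U)m) + μ(D∩B)·∫_D (P_{C_x}(v↔o) − M) dμ ≤ μ(D)(μ(O_x∩B) − μ(O_x)m)`
— BENCH row M2-R12 with the (att) member (prim-rate lane). [cite: VandenbergHaggstromKahn2005, Thm. 1.4 and eq. (2) (pp. 2, 7)] -/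
theorem level0Margin_ge_harris_add_attachment (w : Sym2 V → unitInterval) (E : Set (Sym2 V))
    (hE : ∀ e, e ∉ E → (w e : ℝ) = 0) (x b o v : V) (hxv : x ≠ v) (M : BondConfig V → ℝ)
    (hM : ∀ (ω : BondConfig V) (U : Set V),
      (openGraph {e | e ∈ E ∧ ∀ z ∈ e, z ∈ openCluster ω x ∨ z ∈ U}).Reachable x b →
        (prodBernoulli w).real {η : BondConfig V |
          (openGraph (η \ {e | ∃ z ∈ e, z ∈ openCluster ω x ∨ z ∈ U})).Reachable v o} ≤ M ω) :
    (prodBernoulli w).real ({ω : BondConfig V | ¬ (openGraph ω).Reachable x v} ∩ openConn o v) *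
          ((prodBernoulli w).real (openConn v x ∩ openConn x b) -
            (prodBernoulli w).real (openConn v x) * (prodBernoulli w).real (openConn x b)) +
        (prodBernoulli w).real {ω : BondConfig V | ¬ (openGraph ω).Reachable x v} *
          ((prodBernoulli w).real ((openConn o x ∪ openConn o v) ∩ openConn x b) -
            (prodBernoulli w).real (openConn o x ∪ openConn o v) * (prodBernoulli w).real (openConn x b)) +
        (prodBernoulli w).real ({ω : BondConfig V | ¬ (openGraph ω).Reachable x v} ∩ openConn x b) *
          (∫ ω in {ω : BondConfig V | ¬ (openGraph ω).Reachable x v},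
            ((prodBernoulli w).real {η : BondConfig V |
                (openGraph (η \ {e | ∃ z ∈ e, z ∈ openCluster ω x})).Reachable v o} - M ω) ∂(prodBernoulli w)) ≤
      (prodBernoulli w).real {ω : BondConfig V | ¬ (openGraph ω).Reachable x v} *
        ((prodBernoulli w).real (openConn o x ∩ openConn x b) -
          (prodBernoulli w).real (openConn o x) * (prodBernoulli w).real (openConn x b)) := by
  have hid := level0Margin_eq_harris_add_repulsion w x b o v
  have hrep := twoCluster_repulsion_openConn_ge_attachment w E hE x v b o hxv M hM
  have hvo : (openConn v o : Set (BondConfig V)) = openConn o v := KNPreFKG.openConn_symm v o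
  have hDBO : {ω : BondConfig V | ¬ (openGraph ω).Reachable x v} ∩ openConn x b ∩ openConn o v =
      {ω : BondConfig V | ¬ (openGraph ω).Reachable x v} ∩ openConn o v ∩ openConn x b := by
    rw [Set.inter_assoc, Set.inter_comm (openConn x b) (openConn o v), ← Set.inter_assoc]
  rw [hvo, hDBO] at hrep
  linarith [hid, hrep]

/-- **Level-0 CSH margin with the Harris term and the repulsion slack floored by the GLAUBER member** (all weights, every pair `e`; notation of
`level0Margin_eq_harris_add_repulsion`, `P_W(v↔o)` the residual connection probability off the pairs meeting `W`):
  `μ(D∩O_v)(μ(Q∩B) − μ(Q)m) + μ(D)(μ(U∩B) − μ(U)m) + μ(D)·w_e(1−w_e)·∫ 1_D(ω∪e)·1{e pivotal for x↔b}·(P_{C_x(ω∖e)}(v↔o) − P_{C_x(ω∪e)}(v↔o)) dμ`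
  `≤ μ(D)(μ(O_x∩B) − μ(O_x)m)`
— BENCH row M2-R12 with the Glauber member of row M2-R9 (kernel `twoCluster_repulsion_ge_glauberTerm`; all weights, no `x ≠ v` needed: at `x = v`
every term vanishes).
[cite: VandenbergHaggstromKahn2005, Thm. 1.3 (p. 6), Thm. 1.4 and eq. (2) (pp. 2, 7)] -/
theorem level0Margin_ge_harris_add_glauber (w : Sym2 V → unitInterval) (x b o v : V) (e : Sym2 V) :
    (prodBernoulli w).real ({ω : BondConfig V | ¬ (openGraph ω).Reachable x v} ∩ openConn o v) *
          ((prodBernoulli w).real (openConn v x ∩ openConn x b) -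
            (prodBernoulli w).real (openConn v x) * (prodBernoulli w).real (openConn x b)) +
        (prodBernoulli w).real {ω : BondConfig V | ¬ (openGraph ω).Reachable x v} *
          ((prodBernoulli w).real ((openConn o x ∪ openConn o v) ∩ openConn x b) -
            (prodBernoulli w).real (openConn o x ∪ openConn o v) * (prodBernoulli w).real (openConn x b)) +
        (prodBernoulli w).real {ω : BondConfig V | ¬ (openGraph ω).Reachable x v} *
          ((w e : ℝ) * (1 - w e) *
            ∫ ω, ({ω : BondConfig V | ¬ (openGraph ω).Reachable x v}).indicator (fun _ => (1 : ℝ)) (insert e ω) *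
              (((if b ∈ openCluster (insert e ω) x then (1 : ℝ) else 0) - (if b ∈ openCluster (ω \ {e}) x then (1 : ℝ) else 0)) *
                ((prodBernoulli w).real {η : BondConfig V |
                    (openGraph (η \ {f | ∃ u ∈ openCluster (ω \ {e}) x, u ∈ f})).Reachable v o} -
                  (prodBernoulli w).real {η : BondConfig V |
                    (openGraph (η \ {f | ∃ u ∈ openCluster (insert e ω) x, u ∈ f})).Reachable v o})) ∂(prodBernoulli w)) ≤
      (prodBernoulli w).real {ω : BondConfig V | ¬ (openGraph ω).Reachable x v} *
        ((prodBernoulli w).real (openConn o x ∩ openConn x b) -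
          (prodBernoulli w).real (openConn o x) * (prodBernoulli w).real (openConn x b)) := by
  set μ := prodBernoulli w with hμ
  have hmeas : ∀ T : Set (BondConfig V), MeasurableSet T := fun _ => MeasurableSet.of_discrete
  set D : Set (BondConfig V) := {ω : BondConfig V | ¬ (openGraph ω).Reachable x v} with hD
  have hid := level0Margin_eq_harris_add_repulsion w x b o v
  set F : Set V → ℝ := fun W => if b ∈ W then 1 else 0 with hF
  have hFmono : Monotone F := by
    intro W W' h
    simp only [hF]
    by_cases hb : b ∈ W
    · rw [if_pos hb, if_pos (h hb)]
    · rw [if_neg hb]; split_ifs <;> norm_num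
  have hrep := twoCluster_repulsion_ge_glauberTerm w x v o e F hFmono
  rw [← hμ, ← hD] at hrep hid
  -- identify the two `F`-integrals with measures
  have hFind : (fun ω : BondConfig V => F (openCluster ω x)) = (openConn x b).indicator fun _ => (1 : ℝ) := by
    funext ω; simp only [hF, Set.indicator_apply]; rfl
  have h1 : ∫ ω in D, F (openCluster ω x) ∂μ = μ.real (D ∩ openConn x b) := by
    rw [hFind, integral_indicator (hmeas _), Measure.restrict_restrict (hmeas _), integral_const, smul_eq_mul, mul_one,
      measureReal_restrict_apply_univ, Set.inter_comm]
  have h2 : ∫ ω in D ∩ openConn v o, F (openCluster ω x) ∂μ = μ.real (D ∩ openConn o v ∩ openConn x b) := by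
    rw [hFind, integral_indicator (hmeas _), Measure.restrict_restrict (hmeas _), integral_const, smul_eq_mul, mul_one,
      measureReal_restrict_apply_univ, Set.inter_comm, KNPreFKG.openConn_symm v o]
  have hvo : D ∩ openConn v o = D ∩ openConn o v := by rw [KNPreFKG.openConn_symm v o]
  rw [h1, h2, hvo] at hrep
  have hF' : ∀ ω : BondConfig V, F (openCluster (insert e ω) x) - F (openCluster (ω \ {e}) x) =
      (if b ∈ openCluster (insert e ω) x then (1 : ℝ) else 0) - (if b ∈ openCluster (ω \ {e}) x then (1 : ℝ) else 0) := fun ω => rfl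
  simp_rw [hF'] at hrep
  linarith [hid, hrep]

end QuantBHK

end Summit.CriticalPhenomena.PercolationContinuityZ3.Theorems
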